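import Summits.Ventures.Crystal3D.Theorems.StickyWulffConstantPolycrystalWulffBoundRungSuperTree
import Summits.Ventures.Crystal3D.Theorems.StickyWulffConstantPolycrystalWulffBoundRungSingleAxisTexture

/-!
# `PolycrystalWulffBound`, line `PolyDensity`: the tree-of-super-grains rung in texture vocabulary, FREE
# form (explicit slide budget, no azimuth test, no charges used; crux `stmt-Ventures-19482`)

Route `StickyWulffConstant` of the venture `Summits/Ventures/Crystal3D`, second prover lane (poly-p2,
gen 13).  `rung_superTree_texture` (`…RungSuperTreeTexture`) consumes the per-texture aggregate azimuth
test.  This file states the same chain (cell rung `rung_superTree_cells`, merging of the cells of each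
grain, regrouping of the cell wall sum by grains) with the slide budget left EXPLICIT on the right:
`6·2^{1/3}(√2·Vol)^{2/3} ≤ (Σ Per − ΣΣ ι) + (1/√6)·Σ_{nd f = nd g, slid, τ f ≠ τ g} Σ_{a ∈ s f, b ∈ s g}
|⟪wS (nd f), ν_{ab}⟫|·facetArea` (`rung_superTree_texture_free`) — the form on which other tests (averaging
over the three `⟨112⟩` directions of each node: `…RungSuperTreeCharge`; relabelling) are bolted.
WHAT THIS IS NOT: a bound by `En` alone; the crux is not claimed.
-/

noncomputable section

open scoped BigOperators InnerProductSpace ENNReal Pointwise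
open MeasureTheory Filter Set

namespace Summit.Ventures.Crystal3D.Cruxes.PolycrystalWulffBound.PolyDensity

open Summit.Ventures.Crystal3D.Theorems
open Summit.Ventures.Crystal3D.Cruxes.TextureLiminf.TexShadow (per polytope facetArea supportFn E3
  PolytopeCalculus stub_polytopeCalculus)
open Literature.MathematicalPhysics.StatisticalMechanics (fccStacking barlowStacking IsHaggSeq perimeter)

/-- **Rung `rung_superTree_texture_free`** (texture vocabulary, explicit slide budget): a texture
presented as a sorted tree of super-grains satisfies `6·2^{1/3}(√2·Vol)^{2/3} ≤ (Σ Per − ΣΣ ι) +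
(1/√6)·Σ_{nd f = nd g, slid (nd f), τ f ≠ τ g} Σ_{a ∈ s f, b ∈ s g} |⟪wS (nd f), ν_{ab}⟫|·facetArea`. -/
theorem rung_superTree_texture_free :
    let Λ : Set (EuclideanSpace ℝ (Fin 3)) := Literature.MathematicalPhysics.StatisticalMechanics.fccStacking 1 (Real.sqrt (2 / 3));
    let Brl : (ℤ → ℤ) → Set (EuclideanSpace ℝ (Fin 3)) := Literature.MathematicalPhysics.StatisticalMechanics.barlowStacking 1 (Real.sqrt (2 / 3));
    let Ax : EuclideanSpace ℝ (Fin 3) → (EuclideanSpace ℝ (Fin 3) ≃ₗᵢ[ℝ] EuclideanSpace ℝ (Fin 3)) → (EuclideanSpace ℝ (Fin 3) ≃ₗᵢ[ℝ] EuclideanSpace ℝ (Fin 3)) → Prop := fun m A B => ∃ (L : EuclideanSpace ℝ (Fin 3) ≃ₗᵢ[ℝ] EuclideanSpace ℝ (Fin 3)) (s₁ s₂ : EuclideanSpace ℝ (Fin 3)) (σ σ' : ℤ → ℤ), Literature.MathematicalPhysics.StatisticalMechanics.IsHaggSeq σ ∧ Literature.MathematicalPhysics.StatisticalMechanics.IsHaggSeq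 σ' ∧ L (EuclideanSpace.single (2 : Fin 3) (1 : ℝ)) = m ∧ A '' Λ ⊆ (fun q => L q + s₁) '' Brl σ ∧ B '' Λ ⊆ (fun q => L q + s₂) '' Brl σ';
    let CoAx : (EuclideanSpace ℝ (Fin 3) ≃ₗᵢ[ℝ] EuclideanSpace ℝ (Fin 3)) → (EuclideanSpace ℝ (Fin 3) ≃ₗᵢ[ℝ] EuclideanSpace ℝ (Fin 3)) → Prop := fun A B => ∃ m, Ax m A B;
    let Φ : EuclideanSpace ℝ (Fin 3) → ℝ := fun ν => Real.sqrt 2 / 4 * ∑ᶠ w ∈ {w ∈ Λ | ‖w‖ = 1}, |⟪w, ν⟫_ℝ|;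
    let Per : Set (EuclideanSpace ℝ (Fin 3)) → Set (EuclideanSpace ℝ (Fin 3)) → ℝ := fun K S => (⨆ (ξ : EuclideanSpace ℝ (Fin 3) → EuclideanSpace ℝ (Fin 3)) (_ : ContDiff ℝ 1 ξ ∧ HasCompactSupport ξ ∧ ∀ z, ξ z ∈ K), ENNReal.ofReal (∫ z in S, Literature.MathematicalPhysics.StatisticalMechanics.fieldDivergence ξ z)).toReal;
    let ι : Set (EuclideanSpace ℝ (Fin 3)) → Set (EuclideanSpace ℝ (Fin 3)) → Set (EuclideanSpace ℝ (Fin 3)) → ℝ := fun K S₁ S₂ => (Per K S₁ + Per K S₂ - Per K (S₁ ∪ S₂)) / 2;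
    let W : (EuclideanSpace ℝ (Fin 3) ≃ₗᵢ[ℝ] EuclideanSpace ℝ (Fin 3)) → Set (EuclideanSpace ℝ (Fin 3)) := fun A => {y | ∀ ν : EuclideanSpace ℝ (Fin 3), ⟪y, ν⟫_ℝ ≤ Φ (A.symm ν)};
    let Tex : (n : ℕ) → (Fin n → Set (EuclideanSpace ℝ (Fin 3))) → (Fin n → (EuclideanSpace ℝ (Fin 3) ≃ₗᵢ[ℝ] EuclideanSpace ℝ (Fin 3))) → (Fin n → Fin n → ℝ) → (Fin n → Fin n → EuclideanSpace ℝ (Fin 3)) → Prop := fun n G A c m => (∀ f : Fin n, Literature.MathematicalPhysics.StatisticalMechanics.HasFinitePerimeter (G f) ∧ volume (G f) < ⊤) ∧ (∀ f g, f ≠ g → Disjoint (G f) (G g)) ∧ (∀ f g, f ≠ g → 0 ≤ c f g) ∧ (∀ f g, f ≠ g → ¬ CoAx (A f) (A g) → m f g = 0 ∧ 1 ≤ c f g) ∧ (∀ f g, f ≠ g → CoAx (A f) (A g) → A f '' Λ ≠ A g '' Λ → Ax (m f g) (A f) (A g) ∧ 1 / 2 ≤ c f g);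
    let Vol : (n : ℕ) → (Fin n → Set (EuclideanSpace ℝ (Fin 3))) → ℝ := fun n G => (volume (⋃ f : Fin n, G f)).toReal;
    ∀ (k' : ℕ) (Hc : Fin k' → Finset ((EuclideanSpace ℝ (Fin 3)) × ℝ)) (nv : Fin k' → Fin k' → EuclideanSpace ℝ (Fin 3)),
      (∀ j, Bornology.IsBounded (polytope (Hc j))) →
      (∀ j j', j ≠ j' → Disjoint (polytope (Hc j)) (polytope (Hc j'))) →
      (∀ i j, nv j i = -nv i j) →
      (∀ j j', j ≠ j' → ‖nv j j'‖ = 1 ∧ ∃ b : ℝ,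
        closure (polytope (Hc j)) ∩ closure (polytope (Hc j')) ⊆ {x | ⟪nv j j', x⟫_ℝ = b}) →
    ∀ (n : ℕ) (G : Fin n → Set (EuclideanSpace ℝ (Fin 3)))
      (A : Fin n → (EuclideanSpace ℝ (Fin 3) ≃ₗᵢ[ℝ] EuclideanSpace ℝ (Fin 3)))
      (c : Fin n → Fin n → ℝ) (m : Fin n → Fin n → EuclideanSpace ℝ (Fin 3)),
      Tex n G A c m →
    ∀ (s : Fin n → Finset (Fin k')),
      (∀ f, G f = ⋃ j ∈ s f, polytope (Hc j)) →
      (∀ f g, f ≠ g → Disjoint (s f) (s g)) →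
      (∀ j, ∃ f, j ∈ s f) →
    ∀ (τ : Fin n → Bool) (N : ℕ) (par : Fin N → Fin (N + 1)) (nrm : Fin N → EuclideanSpace ℝ (Fin 3))
      (thr : Fin N → ℝ) (nd : Fin n → Fin (N + 1))
      (Aref : Fin (N + 1) → (EuclideanSpace ℝ (Fin 3) ≃ₗᵢ[ℝ] EuclideanSpace ℝ (Fin 3)))
      (slid : Fin (N + 1) → Bool) (mS uS wS : Fin (N + 1) → EuclideanSpace ℝ (Fin 3)) (δ : ℝ),
      (∀ i, (par i : ℕ) ≤ i) → (∀ i, ‖nrm i‖ = 1) →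
      (∀ i (t : ℝ), volume (W (Aref i.succ) ∩ {y | t < ⟪y, nrm i⟫_ℝ}) =
        volume (W (Aref (par i)) ∩ {y | t < ⟪y, nrm i⟫_ℝ})) →
      (∀ i f, nd f = i.succ → ∀ x ∈ G f, thr i < ⟪x, nrm i⟫_ℝ) → 0 < δ →
      (∀ i f, nd f = par i → ∀ x ∈ G f,
        ⟪x, nrm i⟫_ℝ < thr i ∨ ∀ g, nd g = i.succ → ∀ y ∈ G g, δ ≤ dist x y) →
      (∀ f g, nd f ≠ nd g → (∀ i, ¬ (nd f = par i ∧ nd g = i.succ)) →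
        (∀ i, ¬ (nd g = par i ∧ nd f = i.succ)) → ∀ x ∈ G f, ∀ y ∈ G g, δ ≤ dist x y) →
      (∀ f, slid (nd f) = false → W (A f) = W (Aref (nd f))) →
      (∀ f, slid (nd f) = true → Ax (mS (nd f)) (Aref (nd f)) (A f)) →
      (∀ F, slid F = true → ‖uS F‖ = 1 ∧ ‖wS F‖ = 1 ∧ ⟪uS F, mS F⟫_ℝ = 0 ∧ ⟪wS F, mS F⟫_ℝ = 0 ∧
        ⟪wS F, uS F⟫_ℝ = 0) →
      (∀ F, slid F = true → uS F ∈ Aref F '' Λ ∧ (ℝ ∙ uS F)ᗮ.reflection '' (Aref F '' Λ) = Aref F '' Λ) →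
      (∀ f g, nd f = nd g → τ f = τ g → A f '' Λ = A g '' Λ) →
      (∀ i, slid (par i) = true → ⟪nrm i, wS (par i)⟫_ℝ = 0) →
      (∀ i, slid i.succ = true → ⟪nrm i, wS i.succ⟫_ℝ = 0) →
    6 * (2 : ℝ) ^ ((1 : ℝ) / 3) * (Real.sqrt 2 * Vol n G) ^ ((2 : ℝ) / 3) ≤
      (∑ f, Per (W (A f)) (G f) - ∑ f, ∑ g, (if f = g then 0 else ι (W (A f)) (G f) (G g))) +
        1 / Real.sqrt 6 * ∑ f, ∑ g, (if (nd f = nd g ∧ slid (nd f) = true ∧ τ f ≠ τ g) then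
          ∑ a ∈ s f, ∑ b ∈ s g, |⟪wS (nd f), nv a b⟫_ℝ| *
            facetArea (closure (polytope (Hc a)) ∩ closure (polytope (Hc b))) (nv a b) else 0) := by
  intro Λ Brl Ax CoAx Φ Per ι W Tex Vol k' Hc nv hbd hdisjQ hanti hplane n G A c m hTex
    s hGs hsdisj hcov τ N par nrm thr nd Aref slid mS uS wS δ hpar hn1 hprof hGt hδ hPt hfar hN1 hN2
    hON hBM hτ hNa hNb
  classical
  rcases Nat.eq_zero_or_pos n with hn | hn
  · subst hn
    show 6 * (2 : ℝ) ^ ((1 : ℝ) / 3) * (Real.sqrt 2 * (volume (⋃ f : Fin 0, G f)).toReal) ^ ((2 : ℝ) / 3) ≤ _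
    rw [iUnion_of_empty, measure_empty, ENNReal.toReal_zero, mul_zero, Real.zero_rpow (by norm_num),
      mul_zero]
    simp
  -- cells, their grains
  set Q : Fin k' → Set E3 := fun j => polytope (Hc j) with hQ
  choose gr hgr using hcov
  have hgr_eq : ∀ j f, j ∈ s f → gr j = f := by
    intro j f hj
    by_contra h
    exact Finset.disjoint_left.1 (hsdisj _ _ h) (hgr j) hj
  have hfilter : ∀ f, Finset.univ.filter (fun j => gr j = f) = s f := by
    intro f; ext j
    simp only [Finset.mem_filter, Finset.mem_univ, true_and]
    exact ⟨fun h => h ▸ hgr j, fun h => hgr_eq j f h⟩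
  have hQpoly : ∀ j, ∃ (k : ℕ) (H' : Fin k → Finset (E3 × ℝ)), Q j = ⋃ i, polytope (H' i) :=
    fun j => ⟨1, fun _ => Hc j, by ext x; simp [hQ]⟩
  have hQvol : ∀ j, volume (Q j) < ⊤ := fun j => (hbd j).measure_lt_top
  have hmemG : ∀ j, ∀ x ∈ polytope (Hc j), x ∈ G (gr j) := by
    intro j x hx; rw [hGs]; exact mem_biUnion (hgr j) hx
  -- the cell rung
  set fa : Fin k' → Fin k' → ℝ := fun a b =>
    facetArea (closure (polytope (Hc a)) ∩ closure (polytope (Hc b))) (nv a b) with hfa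
  have hfa0 : ∀ a b, 0 ≤ fa a b := fun a b => ENNReal.toReal_nonneg
  have hR := rung_superTree_cells k' Hc (fun j => A (gr j)) nv (fun j => τ (gr j)) N par nrm thr
    (fun j => nd (gr j)) Aref slid mS uS wS δ hbd hdisjQ hanti hplane hpar hn1 hprof
    (fun i j hj x hx => hGt i (gr j) hj x (hmemG j x hx)) hδ
    (fun i j hj x hx => (hPt i (gr j) hj x (hmemG j x hx)).imp_right
      fun h j' hj' y hy => h (gr j') hj' y (hmemG j' y hy))
    (fun j j' h h1 h2 x hx y hy => hfar (gr j) (gr j') h h1 h2 x (hmemG j x hx) y (hmemG j' y hy))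
    (fun j hj => hN1 (gr j) hj) (fun j hj => hN2 (gr j) hj) hON hBM
    (fun j j' h h' => wulffBody_eq_of_image_eq (hτ _ _ h h')) hNa hNb
  -- (i) volumes agree
  have hUnion : (⋃ j, ⋂ p ∈ Hc j, {x : E3 | ⟪p.1, x⟫_ℝ < p.2}) = ⋃ f, G f := by
    apply subset_antisymm
    · intro x hx
      obtain ⟨j, hj⟩ := mem_iUnion.1 hx
      exact mem_iUnion.2 ⟨gr j, hmemG j x hj⟩
    · intro x hx
      obtain ⟨f, hf⟩ := mem_iUnion.1 hx
      rw [hGs] at hf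
      obtain ⟨j, -, hj⟩ := mem_iUnion₂.1 hf
      exact mem_iUnion.2 ⟨j, hj⟩
  -- (ii) free energies agree: merge the cells of each grain
  have hWc : ∀ f, IsCompact (W (A f)) := fun f => isCompact_cruxWulffBody (A f)
  have hWv : ∀ f, Convex ℝ (W (A f)) := fun f => convex_cruxWulffBody (A f)
  have hW0 : ∀ f, (0 : E3) ∈ W (A f) := fun f => zero_mem_cruxWulffBody (A f)
  have hWs : ∀ f, -W (A f) = W (A f) := fun f => neg_cruxWulffBody_eq (A f)
  have hmerge := freeEnergy_eq_merged_texture Q hQpoly hQvol hdisjQ gr Finset.univ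
    (fun j => Finset.mem_univ _) (fun f => W (A f)) hWc hWv hW0 hWs
  have hUf : ∀ f, (⋃ j ∈ Finset.univ.filter (fun j => gr j = f), Q j) = G f := by
    intro f; rw [hfilter, hGs]
  simp only [hUf] at hmerge
  have hFr : (∑ j, Per (W (A (gr j))) (⋂ p ∈ Hc j, {x : E3 | ⟪p.1, x⟫_ℝ < p.2}) -
      ∑ j, ∑ j', (if j = j' then 0 else ι (W (A (gr j))) (⋂ p ∈ Hc j, {x : E3 | ⟪p.1, x⟫_ℝ < p.2})
        (⋂ p ∈ Hc j', {x : E3 | ⟪p.1, x⟫_ℝ < p.2}))) =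
      ∑ f, Per (W (A f)) (G f) - ∑ f, ∑ g, (if f = g then 0 else ι (W (A f)) (G f) (G g)) := by
    rw [← Finset.sum_sub_distrib, ← Finset.sum_sub_distrib]
    exact hmerge
  -- (iii) the cell wall sum regrouped by grains
  set t : Fin k' → Fin k' → ℝ := fun a b => |⟪wS (nd (gr a)), nv a b⟫_ℝ| * fa a b with ht
  have hregroup : (∑ j, ∑ j', (if (nd (gr j) = nd (gr j') ∧ slid (nd (gr j)) = true ∧ τ (gr j) ≠ τ (gr j'))
        then t j j' else 0)) =
      ∑ f, ∑ g, (if (nd f = nd g ∧ slid (nd f) = true ∧ τ f ≠ τ g) then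
        ∑ a ∈ s f, ∑ b ∈ s g, |⟪wS (nd f), nv a b⟫_ℝ| * fa a b else 0) := by
    have hmaps : ∀ j ∈ (Finset.univ : Finset (Fin k')), gr j ∈ (Finset.univ : Finset (Fin n)) :=
      fun j _ => Finset.mem_univ _
    rw [← Finset.sum_fiberwise_of_maps_to hmaps]
    refine Finset.sum_congr rfl fun f _ => ?_
    rw [hfilter]
    have hinner : ∀ a ∈ s f, (∑ j', (if (nd (gr a) = nd (gr j') ∧ slid (nd (gr a)) = true ∧
        τ (gr a) ≠ τ (gr j')) then t a j' else 0)) =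
        ∑ g, (if (nd f = nd g ∧ slid (nd f) = true ∧ τ f ≠ τ g) then
          ∑ b ∈ s g, |⟪wS (nd f), nv a b⟫_ℝ| * fa a b else 0) := by
      intro a ha
      have hta : ∀ b, t a b = |⟪wS (nd f), nv a b⟫_ℝ| * fa a b := fun b => by
        simp only [ht, hgr_eq a f ha]
      rw [hgr_eq a f ha, ← Finset.sum_fiberwise_of_maps_to hmaps]
      refine Finset.sum_congr rfl fun g _ => ?_
      rw [hfilter]
      by_cases hfg : nd f = nd g ∧ slid (nd f) = true ∧ τ f ≠ τ g
      · rw [if_pos hfg]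
        refine Finset.sum_congr rfl fun b hb => ?_
        rw [hgr_eq b g hb, if_pos hfg, hta]
      · rw [if_neg hfg]
        refine Finset.sum_eq_zero fun b hb => ?_
        rw [hgr_eq b g hb, if_neg hfg]
    rw [Finset.sum_congr rfl hinner, Finset.sum_comm]
    refine Finset.sum_congr rfl fun g _ => ?_
    by_cases hfg : nd f = nd g ∧ slid (nd f) = true ∧ τ f ≠ τ g
    · simp only [if_pos hfg]
    · simp only [if_neg hfg, Finset.sum_const_zero]
  -- (iv) assemble
  show 6 * (2 : ℝ) ^ ((1 : ℝ) / 3) * (Real.sqrt 2 * (volume (⋃ f, G f)).toReal) ^ ((2 : ℝ) / 3) ≤ _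
  have hR' : 6 * (2 : ℝ) ^ ((1 : ℝ) / 3) * (Real.sqrt 2 * (volume (⋃ f, G f)).toReal) ^ ((2 : ℝ) / 3) ≤
      (∑ f, Per (W (A f)) (G f) - ∑ f, ∑ g, (if f = g then 0 else ι (W (A f)) (G f) (G g))) +
        1 / Real.sqrt 6 * ∑ j, ∑ j', (if (nd (gr j) = nd (gr j') ∧ slid (nd (gr j)) = true ∧
          τ (gr j) ≠ τ (gr j')) then t j j' else 0) := by
    refine le_trans (le_of_eq ?_) (le_trans hR (le_of_eq ?_))
    · show _ = 6 * (2 : ℝ) ^ ((1 : ℝ) / 3) *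
        (Real.sqrt 2 * (volume (⋃ j, ⋂ p ∈ Hc j, {x : E3 | ⟪p.1, x⟫_ℝ < p.2})).toReal) ^ ((2 : ℝ) / 3)
      rw [hUnion]
    · show (∑ j, Per (W (A (gr j))) (⋂ p ∈ Hc j, {x : E3 | ⟪p.1, x⟫_ℝ < p.2}) -
          ∑ j, ∑ j', (if j = j' then 0 else ι (W (A (gr j))) (⋂ p ∈ Hc j, {x : E3 | ⟪p.1, x⟫_ℝ < p.2})
            (⋂ p ∈ Hc j', {x : E3 | ⟪p.1, x⟫_ℝ < p.2}))) +
          1 / Real.sqrt 6 * ∑ j, ∑ j', (if (nd (gr j) = nd (gr j') ∧ slid (nd (gr j)) = true ∧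
            τ (gr j) ≠ τ (gr j')) then t j j' else 0) = _
      rw [hFr]
  rw [hregroup] at hR'
  exact hR'

end Summit.Ventures.Crystal3D.Cruxes.PolycrystalWulffBound.PolyDensity

end
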